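import Summits.QuantumFields.YangMills.Theorems.UnitScaleTiltProp8EulerLagrangeIter
import HarnessLib

/-!
# Route `UnitScaleTilt`, crux K1 «MinimiserStabilityRegPr» (stmt-QuantumFields-19200), stub `stub_prop8` (V2) — sub-lemma V2-EL, part 7h:
# **THE k-FOLD EULER–LAGRANGE EQUATION ALONG EVERY AMBIENT DIRECTION** (`exists_tangent_lin_eq_zero_iter_family`, `…_of_isCritR2_family`)

Cell `ym3-torus` ∕ fleet seat `ym-ust-19200-p2` g4.  Part 7d moved ONE bond `b₀ ∉ T₀`; here the ambient family `Γ₀(t)` through `U₀` is ARBITRARY (every bond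
differentiable at `t = 0`): there is a bond field `ξ` which AGREES WITH THE AMBIENT VELOCITIES at every bond outside `T₀` (`ξ(b) = d/dt|₀ Γ₀(t)(b)U₀(b)^*`) and
satisfies `Lin_{U₀}(ξ) = 0` — the first variation of the `SU(2)` Wilson action vanishes on the k-fold tangent vector over ANY direction of the free coordinates,
the values on the iterated central bonds `T₀` being the induced multiplier part.  This is the form a chart-based assembly of [Balaban1985Variational] Sect. F
consumes («the image of U′_k is a minimum of g(A′)», p. 302: all directional derivatives in the free coordinates vanish).  Carrier corollary for `IsCritR2`.
Sorry-free, no definition. [folklore] ∕ cited.  References: T. Bałaban, CMP 102 (1985) 277–309 [Balaban1985Variational] ((127) p.297, (158) p.302);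
CMP 109 (1987) 249–301 [Balaban1987RG1] ((0.11) p.253).
-/

noncomputable section

open scoped BigOperators Matrix.Norms.L2Operator Matrix Topology
open Filter Function Asymptotics NormedSpace

namespace Summit.QuantumFields.YangMills.Theorems.Prop8Criticality

open Literature.MathematicalPhysics.QuantumFieldTheory.Balaban1983to89
open T4Continuum AveragingRT BlockAveraging BlockAveragingHaarAC BlockAveragingEMLHaarAC ExpMeanLog
open Summit.QuantumFields.YangMills.Theorems.BlockAvgCorrector (stokesConst stokesConst_nonneg emlWeight_pos emlWeight_le_one)

variable {P : Params}

/-! ## §1 One tower -/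

/-- **THE k-FOLD EULER–LAGRANGE EQUATION ALONG EVERY AMBIENT DIRECTION.**  Under the hypotheses of `exists_tangent_lin_eq_zero_iter` (iterated averages of `U₀`
`t₀`-small, `U₀` minimising the `SU(2)` Wilson action over a set containing the germ of its k-fold fibre, tower `T` closed downwards with `T_k` everything), for
every family `Γ₀(t)` with `Γ₀(0) = U₀` and every bond differentiable at `0` there is `ξ` with `HasDerivAt (t ↦ Γ₀(t)(b)U₀(b)^*) (ξ b) 0` for every `b ∉ T₀` and
`Lin_{U₀}(ξ) = 0`. [cite: Balaban1985Variational, (127) p.297, (158) p.302] -/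
theorem exists_tangent_lin_eq_zero_iter_family (k : ℕ) (hk : k ≤ P.m + P.K) {t₀ : ℝ} (ht₀ : 0 < t₀)
    (hsmall : stokesConst P * t₀ ≤ emlWeight P / 1000)
    (U₀ : GaugeField P 0 (Matrix.specialUnitaryGroup (Fin 2) ℂ))
    (hU₀ : ∀ i, i < k → PlaqSmall t₀ (Averaging.iter (fun i => blockAvg (P := P) (j := i) (expMeanLogSU (n := Fin 2))) i U₀))
    {S : Set (GaugeField P 0 (Matrix.specialUnitaryGroup (Fin 2) ℂ))}
    (hmin : IsMinOn (fun W : GaugeField P 0 (Matrix.specialUnitaryGroup (Fin 2) ℂ) => wilsonAction4 W) S U₀)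
    (hS : ∃ δ : ℝ, 0 < δ ∧ ∀ U : GaugeField P 0 (Matrix.specialUnitaryGroup (Fin 2) ℂ),
      Averaging.iter (fun i => blockAvg (P := P) (j := i) (expMeanLogSU (n := Fin 2))) k U =
        Averaging.iter (fun i => blockAvg (P := P) (j := i) (expMeanLogSU (n := Fin 2))) k U₀ →
        (∀ b, ‖(U b : Matrix (Fin 2) (Fin 2) ℂ) - (U₀ b : Matrix (Fin 2) (Fin 2) ℂ)‖ < δ) → U ∈ S)
    (T : (i : ℕ) → Set (PBond P i)) (hT : ∀ i, i < k → ∀ c : PBond P (i + 1), c ∈ T (i + 1) → centralBond c ∈ T i)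
    (hTk : ∀ c : PBond P k, c ∈ T k)
    (Γ₀ : ℝ → GaugeField P 0 (Matrix.specialUnitaryGroup (Fin 2) ℂ)) (hΓ₀0 : Γ₀ 0 = U₀)
    (hΓ₀diff : ∀ b : PBond P 0, DifferentiableAt ℝ (fun t : ℝ => (Γ₀ t b : Matrix (Fin 2) (Fin 2) ℂ)) 0) :
    ∃ ξ : PBond P 0 → Matrix (Fin 2) (Fin 2) ℂ,
      (∀ b : PBond P 0, b ∉ T 0 →
        HasDerivAt (fun t : ℝ => (Γ₀ t b : Matrix (Fin 2) (Fin 2) ℂ) * star (U₀ b : Matrix (Fin 2) (Fin 2) ℂ)) (ξ b) 0) ∧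
      ∑ p : Plaq P 0, (1 / 2) * ((((((GaugeField.plaqHol U₀ p : Matrix.specialUnitaryGroup (Fin 2) ℂ) : Matrix (Fin 2) (Fin 2) ℂ)) - 1)ᴴ
          * ((ξ ⟨p.src, p.μ⟩
              + (U₀ ⟨p.src, p.μ⟩ : Matrix (Fin 2) (Fin 2) ℂ) * ξ ⟨p.src.shift p.μ, p.ν⟩ * star (U₀ ⟨p.src, p.μ⟩ : Matrix (Fin 2) (Fin 2) ℂ)
              - ((U₀ ⟨p.src, p.μ⟩ * U₀ ⟨p.src.shift p.μ, p.ν⟩ * (U₀ ⟨p.src.shift p.ν, p.μ⟩)⁻¹ : Matrix.specialUnitaryGroup (Fin 2) ℂ) : Matrix (Fin 2) (Fin 2) ℂ)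
                  * ξ ⟨p.src.shift p.ν, p.μ⟩
                  * star ((U₀ ⟨p.src, p.μ⟩ * U₀ ⟨p.src.shift p.μ, p.ν⟩ * (U₀ ⟨p.src.shift p.ν, p.μ⟩)⁻¹ : Matrix.specialUnitaryGroup (Fin 2) ℂ) : Matrix (Fin 2) (Fin 2) ℂ)
              - ((GaugeField.plaqHol U₀ p : Matrix.specialUnitaryGroup (Fin 2) ℂ) : Matrix (Fin 2) (Fin 2) ℂ) * ξ ⟨p.src, p.ν⟩
                  * star ((GaugeField.plaqHol U₀ p : Matrix.specialUnitaryGroup (Fin 2) ℂ) : Matrix (Fin 2) (Fin 2) ℂ))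
            * ((GaugeField.plaqHol U₀ p : Matrix.specialUnitaryGroup (Fin 2) ℂ) : Matrix (Fin 2) (Fin 2) ℂ))).trace).re = 0 := by
  classical
  have hsm : ∀ i, i < k → PlaqSmall t₀ (Averaging.iter (fun i => blockAvg (P := P) (j := i) (expMeanLogSU (n := Fin 2))) i (Γ₀ 0)) := by
    rw [hΓ₀0]; exact hU₀
  obtain ⟨γ, hγ0, hγdiff, hγev, hγT⟩ := exists_iter_lift_curve (P := P) ht₀ hsmall k hk Γ₀ hΓ₀diff hsm T hT
    (fun _ => Averaging.iter (fun i => blockAvg (P := P) (j := i) (expMeanLogSU (n := Fin 2))) k U₀)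
    (fun _ => differentiableAt_const _) (by rw [hΓ₀0]) (fun c hc => absurd (hTk c) hc)
  have hγ0' : γ 0 = U₀ := hγ0.trans hΓ₀0
  have hγS : ∀ᶠ t in 𝓝 (0 : ℝ), γ t ∈ S := by
    obtain ⟨δ, hδpos, hSδ⟩ := hS
    have hnear : ∀ b : PBond P 0, ∀ᶠ t in 𝓝 (0 : ℝ), ‖((γ t b : Matrix.specialUnitaryGroup (Fin 2) ℂ) : Matrix (Fin 2) (Fin 2) ℂ) - (U₀ b : Matrix (Fin 2) (Fin 2) ℂ)‖ < δ := by
      intro b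
      have h1 : Tendsto (fun t : ℝ => ((γ t b : Matrix.specialUnitaryGroup (Fin 2) ℂ) : Matrix (Fin 2) (Fin 2) ℂ)) (𝓝 0)
          (𝓝 ((U₀ b : Matrix.specialUnitaryGroup (Fin 2) ℂ) : Matrix (Fin 2) (Fin 2) ℂ)) := by
        have := (hγdiff b).continuousAt.tendsto
        rwa [hγ0'] at this
      have h2 := h1 (Metric.ball_mem_nhds _ hδpos)
      filter_upwards [h2] with t ht
      rwa [Set.mem_preimage, Metric.mem_ball, dist_eq_norm] at ht
    filter_upwards [hγev, Filter.eventually_all.mpr hnear] with t ht hdist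
    exact hSδ (γ t) ht hdist
  set ξ : PBond P 0 → Matrix (Fin 2) (Fin 2) ℂ := fun b =>
    deriv (fun t : ℝ => ((γ t b : Matrix.specialUnitaryGroup (Fin 2) ℂ) : Matrix (Fin 2) (Fin 2) ℂ) * star (U₀ b : Matrix (Fin 2) (Fin 2) ℂ)) 0 with hξ
  have hξd : ∀ b, HasDerivAt (fun t : ℝ => ((γ t b : Matrix.specialUnitaryGroup (Fin 2) ℂ) : Matrix (Fin 2) (Fin 2) ℂ) * star (U₀ b : Matrix (Fin 2) (Fin 2) ℂ)) (ξ b) 0 :=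
    fun b => ((hγdiff b).mul_const _).hasDerivAt
  have main := lin_eq_zero_of_isMinOn_of_hasDerivAt hmin γ hγS hγ0' ξ hξd
  refine ⟨ξ, fun b hb => ?_, main⟩
  refine (hξd b).congr_of_eventuallyEq ?_
  filter_upwards [hγT b hb] with t ht
  rw [ht]

/-! ## §2 At the d = 3 carrier, for R2-critical configurations -/

section Carrier

open T3ContinuumYM3Torus T3UnitLawDensityEML T3ConstrainedMinimiser T3TiltDescent T3DescentFibreTower T3LevelShift
open T3PrintedRegularMinimiser T3RegularMinimiser T3Thm1CarrierNative
open BlockAveragingEMLHaarAC (emlWeight)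

/-- **THE k-FOLD EULER–LAGRANGE EQUATION OF AN R2-CRITICAL CONFIGURATION ALONG EVERY AMBIENT DIRECTION** (run `K`, comparison height `n`, `k = K − n`):
for every bondwise-differentiable family `Γ₀(t)` through `U₀` and every tower `T` closed downwards with `T_{K−n}` everything, there is `ξ` agreeing with the
ambient velocities off `T₀` with `Lin_{U₀}(ξ) = 0`. [cite: Balaban1985Variational, (127) p.297, (158) p.302, Prop 8 p.304] -/
theorem exists_tangent_lin_eq_zero_of_isCritR2_family (F : T3Family) {n K : ℕ} (hnK : n ≤ K)
    {V : GaugeField (F.P n) 0 (Matrix.specialUnitaryGroup (Fin 2) ℂ)} {U₀ : GaugeField (F.P K) 0 (Matrix.specialUnitaryGroup (Fin 2) ℂ)}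
    (hcrit : IsCritR2 F n K hnK V U₀)
    {t₀ : ℝ} (ht₀ : 0 < t₀) (hsmall : stokesConst (F.P K) * t₀ ≤ emlWeight (F.P K) / 1000)
    (hU₀ : ∀ i, i < K - n → PlaqSmall t₀ (Averaging.iter (fun i => blockAvg (P := F.P K) (j := i) (expMeanLogSU (n := Fin 2))) i U₀))
    (T : (i : ℕ) → Set (PBond (F.P K) i)) (hT : ∀ i, i < K - n → ∀ c : PBond (F.P K) (i + 1), c ∈ T (i + 1) → centralBond c ∈ T i)
    (hTk : ∀ c : PBond (F.P K) (K - n), c ∈ T (K - n))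
    (Γ₀ : ℝ → GaugeField (F.P K) 0 (Matrix.specialUnitaryGroup (Fin 2) ℂ)) (hΓ₀0 : Γ₀ 0 = U₀)
    (hΓ₀diff : ∀ b : PBond (F.P K) 0, DifferentiableAt ℝ (fun t : ℝ => (Γ₀ t b : Matrix (Fin 2) (Fin 2) ℂ)) 0) :
    ∃ ξ : PBond (F.P K) 0 → Matrix (Fin 2) (Fin 2) ℂ,
      (∀ b : PBond (F.P K) 0, b ∉ T 0 →
        HasDerivAt (fun t : ℝ => (Γ₀ t b : Matrix (Fin 2) (Fin 2) ℂ) * star (U₀ b : Matrix (Fin 2) (Fin 2) ℂ)) (ξ b) 0) ∧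
      ∑ p : Plaq (F.P K) 0, (1 / 2) * ((((((GaugeField.plaqHol U₀ p : Matrix.specialUnitaryGroup (Fin 2) ℂ) : Matrix (Fin 2) (Fin 2) ℂ)) - 1)ᴴ
          * ((ξ ⟨p.src, p.μ⟩
              + (U₀ ⟨p.src, p.μ⟩ : Matrix (Fin 2) (Fin 2) ℂ) * ξ ⟨p.src.shift p.μ, p.ν⟩ * star (U₀ ⟨p.src, p.μ⟩ : Matrix (Fin 2) (Fin 2) ℂ)
              - ((U₀ ⟨p.src, p.μ⟩ * U₀ ⟨p.src.shift p.μ, p.ν⟩ * (U₀ ⟨p.src.shift p.ν, p.μ⟩)⁻¹ : Matrix.specialUnitaryGroup (Fin 2) ℂ) : Matrix (Fin 2) (Fin 2) ℂ)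
                  * ξ ⟨p.src.shift p.ν, p.μ⟩
                  * star ((U₀ ⟨p.src, p.μ⟩ * U₀ ⟨p.src.shift p.μ, p.ν⟩ * (U₀ ⟨p.src.shift p.ν, p.μ⟩)⁻¹ : Matrix.specialUnitaryGroup (Fin 2) ℂ) : Matrix (Fin 2) (Fin 2) ℂ)
              - ((GaugeField.plaqHol U₀ p : Matrix.specialUnitaryGroup (Fin 2) ℂ) : Matrix (Fin 2) (Fin 2) ℂ) * ξ ⟨p.src, p.ν⟩
                  * star ((GaugeField.plaqHol U₀ p : Matrix.specialUnitaryGroup (Fin 2) ℂ) : Matrix (Fin 2) (Fin 2) ℂ))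
            * ((GaugeField.plaqHol U₀ p : Matrix.specialUnitaryGroup (Fin 2) ℂ) : Matrix (Fin 2) (Fin 2) ℂ))).trace).re = 0 := by
  classical
  obtain ⟨e, -, hreg, hmin⟩ := hcrit
  have hU₀fib : U₀ ∈ fibre F ℰp n K hnK V := ((mem_regFibrePr_iff (F := F)).mp hreg).1
  have hU₀reg : RegPr F n K e U₀ := ((mem_regFibrePr_iff (F := F)).mp hreg).2
  obtain ⟨δ, hδ, hball⟩ := exists_ball_subset_regPr F n K e U₀ hU₀reg
  have hk : K - n ≤ (F.P K).m + (F.P K).K := by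
    show K - n ≤ F.m + K; omega
  refine exists_tangent_lin_eq_zero_iter_family (P := F.P K) (K - n) hk ht₀ hsmall U₀ hU₀ hmin ⟨δ, hδ, fun U hiter hdist => ?_⟩ T hT hTk Γ₀ hΓ₀0 hΓ₀diff
  refine (mem_regFibrePr_iff (F := F)).mpr ⟨?_, hball U hdist⟩
  rw [mem_fibre_iff] at hU₀fib ⊢
  rw [← hU₀fib]
  exact congrArg (fun W => fieldShift _ W) hiter

end Carrier

end Summit.QuantumFields.YangMills.Theorems.Prop8Criticality

end
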